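import Summits.HodgeConjecture.HodgeConjecture.Theorems.EndoscopicMiddleDegreeMiddleThetaSpanHeckeIdempotents
import Summits.HodgeConjecture.HodgeConjecture.Theorems.MiddleThetaSpan.Negative.MiddleThetaSpanFalseOfEpsNegativeCapWitness

/-!
# Strategy census for crux `EndoscopicMiddleDegree.MiddleThetaSpan` (stmt-HodgeConjecture-13661) — Lean companion

Crux-strategist (wall-breaker) pass, 2026-08-17, `planner-cstrat-stmt-HodgeConjecture-13661-p1-0`.
Prose census: `Cruxes/MiddleThetaSpan/STRATEGY-CENSUS.md`. This file kernel-checks the structural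
claims the census rests on; it proves nothing about ball quotients.

* `refuted_of_concludes` — THE META-OBSTRUCTION. The landed negative lemma
  `MiddleThetaSpan_false_of_epsNegativeCapWitness : EpsNegativeCapWitness → ¬ MiddleThetaSpan` (p80039)
  turns every candidate line / split / strengthening into a refuted conjunction: if stubs
  `S₁, …, S_k` compose to the crux then `EpsNegativeCapWitness → ¬ (S₁ ∧ … ∧ S_k)`. So any skeleton
  `MiddleThetaSpan_of : stub₁ → … → stub_k → MiddleThetaSpan` registered on this crux carries at least
  one stub that the SAME paper witness (ε-negative GL₂-CAP `(2,2)`-pieces at `m = 1`, Disproof F12)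
  kills — which is exactly how the three registered lines died (at `stub_singletonSpan` /
  `stub_thetaSupport` / `stub_thetaSpan`).
* Decomposition attempt D1 (`TypedOrthogonalSplit`, `ThetaKernelVanishing`, glue
  `MiddleThetaSpan_of_split` PROVED): the Hodge-theory half is true (it is the abstract
  `mem_sup_span_orthogonal` of `Theorems/EndoscopicMiddleDegreeOrthogonalSplit` at `T = typedSpan`),
  and the whole falsity of the crux moves into the kernel-vanishing half
  (`thetaKernelVanishing_refuted`). Not filed: its only non-routine leaf is refuted by the witness.
* Decomposition attempt D2 (split by `m`): glue `MiddleThetaSpan_of_at` PROVED; the `m = 1` leaf is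
  refuted by the witness VERBATIM (`middleThetaSpanAt_one_refuted`, the p80039 argument at fixed `m`);
  the `m = 2` leaf is expected false by the same mechanism on `U(6,1)` (Disproof F15). Not filed.
* Strengthenings: `refuted_of_concludes` again (`S⁺ → S`).
-/

noncomputable section

set_option linter.dupNamespace false

namespace Summit.HodgeConjecture.HodgeConjecture.Cruxes.MiddleThetaSpan.StrategyCensus

open Literature.AlgebraicGeometry
open Literature.AlgebraicGeometry.Motives (SchemeOver)
open Literature.AlgebraicGeometry.HodgeTheory
open Literature.AlgebraicGeometry.ShimuraVarieties Literature.AlgebraicTopology.SingularHomology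
open Summit.HodgeConjecture.HodgeConjecture.Theses.EndoscopicMiddleDegree (MiddleThetaSpan)
open Summit.HodgeConjecture.HodgeConjecture.Theorems.MiddleThetaSpan.Negative
  (EpsNegativeCapWitness MiddleThetaSpan_false_of_epsNegativeCapWitness)
open Summit.HodgeConjecture.HodgeConjecture.Cruxes.MiddleThetaSpan.ConjugateDimensionSieve
  (typedSpan middleThetaSpan_iff)

/-! ## The meta-obstruction: every composition to the crux is a refuted conjunction -/

/-- If `S` implies the crux then the ε-negative CAP witness refutes `S`. Instantiate `S` with the
conjunction of the stubs of any skeleton, with any strengthening `S⁺`, or with any leaf of a split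
whose other leaves hold. -/
theorem refuted_of_concludes {S : Prop} (h : S → MiddleThetaSpan) : EpsNegativeCapWitness → ¬ S :=
  fun hW hS => MiddleThetaSpan_false_of_epsNegativeCapWitness hW (h hS)

/-- Two-leaf form: a split `S₁ → S₂ → crux` with `S₁` true leaves `S₂` refuted by the witness. -/
theorem second_leaf_refuted {S₁ S₂ : Prop} (h : S₁ → S₂ → MiddleThetaSpan) (hW : EpsNegativeCapWitness)
    (h₁ : S₁) : ¬ S₂ :=
  fun h₂ => MiddleThetaSpan_false_of_epsNegativeCapWitness hW (h h₁ h₂)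

/-! ## Decomposition attempt D1: Kähler-package half + theta-kernel vanishing -/

/-- **D1, leaf 1 (TRUE; Hodge theory).** Every rational Hodge `(n,n)`-class lies in the typed span
plus the span of the rational Hodge classes cup-orthogonal to the typed span. This is
`mem_sup_span_orthogonal` (landed, `Theorems/EndoscopicMiddleDegreeOrthogonalSplit`) at
`T = typedSpan m X D`, modulo the Kähler-package facts already named there — a support-level corollary,
not a crux. -/
def TypedOrthogonalSplit : Prop :=
  ∀ (m : ℕ) (X : SchemeOver ℂ) (D : UnitaryBallQuotientDatum (2 * (m + 1)) X), 1 ≤ m → m ≤ 2 →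
    ∀ c : complexBetti X (2 * (m + 1)), IsRationalClass c →
      IsOfHodgeType (2 * (m + 1)) X (2 * (m + 1)) (m + 1) (m + 1) c →
        c ∈ typedSpan m X D ⊔ Submodule.span ℂ {e : complexBetti X (2 * (m + 1)) |
          IsRationalClass e ∧ IsOfHodgeType (2 * (m + 1)) X (2 * (m + 1)) (m + 1) (m + 1) e ∧
            ∀ x ∈ typedSpan m X D, cupProduct (two_mul_add_two_mul (m + 1) (m + 1)) e x = 0}

/-- **D1, leaf 2 (FALSE at `m = 1` modulo the witness).** The theta kernel is zero: a rational Hodge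
`(n,n)`-class cup-orthogonal to the typed span vanishes. Its negation is the route's recorded
"kernel `E(D) ≠ 0`" (Disproof F12 / `HigherBlasiusRogawskiClassAtFour`); the live re-cut cruxes
`OrthogonalEnveloped` (stmt-14300) / `IsotypicMiddleClassesAlgebraic` (stmt-14301) are ABOUT this kernel. -/
def ThetaKernelVanishing : Prop :=
  ∀ (m : ℕ) (X : SchemeOver ℂ) (D : UnitaryBallQuotientDatum (2 * (m + 1)) X), 1 ≤ m → m ≤ 2 →
    ∀ e : complexBetti X (2 * (m + 1)), IsRationalClass e →
      IsOfHodgeType (2 * (m + 1)) X (2 * (m + 1)) (m + 1) (m + 1) e →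
        (∀ x ∈ typedSpan m X D, cupProduct (two_mul_add_two_mul (m + 1) (m + 1)) e x = 0) → e = 0

/-- **D1 glue (PROVED).** -/
theorem MiddleThetaSpan_of_split (h₁ : TypedOrthogonalSplit) (h₂ : ThetaKernelVanishing) :
    MiddleThetaSpan := by
  rw [middleThetaSpan_iff]
  intro m X D hm1 hm2 c hc hcH
  have hmem := h₁ m X D hm1 hm2 c hc hcH
  have hle : Submodule.span ℂ {e : complexBetti X (2 * (m + 1)) |
      IsRationalClass e ∧ IsOfHodgeType (2 * (m + 1)) X (2 * (m + 1)) (m + 1) (m + 1) e ∧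
        ∀ x ∈ typedSpan m X D, cupProduct (two_mul_add_two_mul (m + 1) (m + 1)) e x = 0} ≤
      typedSpan m X D := by
    refine Submodule.span_le.2 ?_
    rintro e ⟨heQ, heH, horth⟩
    have he0 : e = 0 := h₂ m X D hm1 hm2 e heQ heH horth
    simp [he0]
  exact (sup_le le_rfl hle) hmem

/-- **D1 verdict.** Given the true leaf, the kernel-vanishing leaf is refuted by the witness: the split
relocates the whole falsity of the crux into one leaf. -/
theorem thetaKernelVanishing_refuted (hW : EpsNegativeCapWitness) (h₁ : TypedOrthogonalSplit) :
    ¬ ThetaKernelVanishing :=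
  second_leaf_refuted (fun a b => MiddleThetaSpan_of_split a b) hW h₁

/-! ## Decomposition attempt D2: split by `m` -/

/-- The crux at one value of `m`. -/
def MiddleThetaSpanAt (m : ℕ) : Prop :=
  ∀ (X : SchemeOver ℂ) (D : UnitaryBallQuotientDatum (2 * (m + 1)) X),
    ∀ c : complexBetti X (2 * (m + 1)), IsRationalClass c →
      IsOfHodgeType (2 * (m + 1)) X (2 * (m + 1)) (m + 1) (m + 1) c → c ∈ typedSpan m X D

/-- **D2 glue (PROVED).** -/
theorem MiddleThetaSpan_of_at (h1 : MiddleThetaSpanAt 1) (h2 : MiddleThetaSpanAt 2) :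
    MiddleThetaSpan := by
  rw [middleThetaSpan_iff]
  intro m X D hm1 hm2 c hc hcH
  obtain rfl | rfl : m = 1 ∨ m = 2 := by omega
  · exact h1 X D c hc hcH
  · exact h2 X D c hc hcH

/-- Conversely each leaf is an instance of the crux (so D2 is an honest conjunction split). -/
theorem middleThetaSpanAt_of (h : MiddleThetaSpan) {m : ℕ} (hm1 : 1 ≤ m) (hm2 : m ≤ 2) :
    MiddleThetaSpanAt m := by
  rw [middleThetaSpan_iff] at h
  exact fun X D c hc hcH => h m X D hm1 hm2 c hc hcH

/-- **D2 verdict, `m = 1` leaf: refuted by the witness** (the p80039 argument, run at fixed `m = 1`). -/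
theorem middleThetaSpanAt_one_refuted (hW : EpsNegativeCapWitness) : ¬ MiddleThetaSpanAt 1 := by
  intro h
  obtain ⟨X, D, e, hSC, hcup, c, hc, hcH, hce⟩ := hW
  have hmem : c ∈ typedSpan 1 X D := h X D c hc hcH
  have hker : typedSpan 1 X D ≤ LinearMap.ker e := by
    refine sup_le (sup_le hSC ?_) ?_
    · refine Submodule.span_le.2 ?_
      rintro z ⟨s, -, d, -, rfl⟩
      exact LinearMap.mem_ker.2 (hcup s d)
    · refine Submodule.span_le.2 ?_
      rintro z ⟨a, -, -, d, -, rfl⟩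
      exact LinearMap.mem_ker.2 (hcup a d)
  exact hce (LinearMap.mem_ker.1 (hker hmem))

/-- Hence, modulo the witness, the crux is equivalent to `False` already through its `m = 1` leaf, and
the `m = 2` leaf cannot rescue the decl (it can only be a separate statement; Disproof F15 expects it
false by the same mechanism on `U(6,1)`). -/
theorem middleThetaSpan_refuted_via_leaf (hW : EpsNegativeCapWitness) : ¬ MiddleThetaSpan :=
  fun h => middleThetaSpanAt_one_refuted hW (middleThetaSpanAt_of h le_rfl (by norm_num))

end Summit.HodgeConjecture.HodgeConjecture.Cruxes.MiddleThetaSpan.StrategyCensus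

end
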